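import Literature.AlgebraicGeometry.AbelianSchemes.PoincareUniversalLocality
import Literature.AlgebraicGeometry.AbelianSchemes.RigidifiedLineBundleComap
import Literature.AlgebraicGeometry.AbelianSchemes.AbelianSchemeSteinOfNoetherian
import Literature.AlgebraicGeometry.AbelianSchemes.RigidifiedTrivialOfOpenCover
import Literature.AlgebraicGeometry.AbelianVarieties.PoincareSheafOfPrincipal
import Literature.AlgebraicGeometry.Modules.DetClassTensor
import Literature.AlgebraicGeometry.Modules.DetClassDual
import Literature.AlgebraicGeometry.Morphisms.SectionsFpqcDescent
import Literature.AlgebraicGeometry.Modules.PullbackReflectsIsoOfFlatSurjective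
import Literature.AlgebraicGeometry.Modules.RankOneDescentAlongH0Iso
import Literature.AlgebraicGeometry.Morphisms.TrivialisationFpqcDescent
import HarnessLib

/-!
# A rigidified line bundle on `A_T` which is trivial after an affine faithfully flat base change `T₁ → T` is trivial
# (fpqc descent of trivialisations; HECKE-LINK H2, D6 brick (u6b))

Layer `Literature/AlgebraicGeometry/AbelianSchemes`, namespace `Literature.AlgebraicGeometry.AbelianSchemes.AbelianSchemeOver`.
THEOREMS ONLY; no definition, no named fact, no instance, no notation, no `sorry`.

[MumfordAV1970] §13 (p. 125) proves the universal property of the dual by first producing the classifying map and the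
isomorphism `(1 × g)^*𝒫 ≅ ℒ` LOCALLY on the test scheme and then descending; for the dual of a QUOTIENT `A/K` (§15
Thm. 1, «the dual of `A/C` is `Â/C^⊥`») the test families lift only after the finite flat base changes `[n] : Â → Â` and
`Â → Â/K′`, so the isomorphism has to be descended along an fpqc (here: affine, flat, surjective) cover `c : T₁ → T`.
For RIGIDIFIED line bundles ([MumfordFogartyKirwan1994] Ch. 6 §2 p. 121; [MilneAV2008] I §8 (b′)) this descent is
automatic, and that is what this file proves, over the generic core ★ `Morphisms/NormalisedGeneratorCoface` + ★
`Morphisms/TrivialisationFpqcDescent` (normalise a generator of `(1_A × c)^*N` along `ε_{T₁}` by the rigidification; its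
two cofaces over `A_{T₂}`, `T₂` a kernel pair of `c`, agree — LEMMA Y + Stein `𝒪_{T₂} ⥲ π_*𝒪_{A_{T₂}}` on global sections +
torsion-freeness along `ε_{T₂}`; descend it by fpqc descent of sections ★ `Morphisms/SectionsFpqcDescent`; `𝒪 → N` is an
isomorphism since it is one after the faithfully flat `1_A × c`, ★ `Modules/PullbackReflectsIsoOfFlatSurjective`):

* §1 base-change squares: `isPullback_prodMap` (`A_{T₁} = A_{T₂} ×_{T₂} T₁` along `1_A × w`), hence `1_A × w` is affine /
  flat / surjective when `w` is, and `isPullback_prodMap_prodMap` (a kernel pair of `c` gives a kernel pair of `1_A × c`);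
* §2 **`RigidifiedLineBundle.nonempty_iso_unit_of_pullback_prodMap`** — `c : T₁ → T` affine, flat, surjective, a kernel
  pair `pr₁, pr₂ : T₂ ⇉ T₁` (`IsPullback pr₁ pr₂ c c`), Stein for `A_{T₂} → T₂` on global functions (`hSt₂`), `N` a
  rigidified line bundle on `A_T` with `(1_A × c)^*N ≅ 𝒪` ⟹ `N ≅ 𝒪`; `…_of_isLocallyNoetherian` (Stein by ★ p750122
  `baseChange_app_bijective` over a locally Noetherian `S`) and `…_of_isLocallyNoetherian'` (`T₂ := T₁ ×_T T₁`);
* §3 the TWO-MODULE form **`RigidifiedLineBundle.nonempty_iso_of_pullback_prodMap`** (`(1_A × c)^*M₁ ≅ (1_A × c)^*M₂ ⟹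
  M₁ ≅ M₂`, through `N := M₁ ⊗ M₂^∨` and determinant classes, à la ★ `RigidifiedTrivialOfOpenCover`) with its
  `_of_isLocallyNoetherian[_of_isPullback]` variants — the `hdesc` input of the universal property of `(Â/K′, 𝒫_B^{rig})`
  (★ `AbelianSchemeQuotientDualPairUnique`, (α2) wiring).

The Zariski companion (open covers instead of `c`) is ★ `AbelianSchemes/RigidifiedTrivialOfOpenCover`.  Cell
`hodgecm-mathlib`, HECKE-LINK socket (B), D6 (u6b) (B-plan1 (g15) ruling 2026-08-29 23:17Z).  HC_CM is proved only
modulo the 7 printed citations until rung 0 closes; nothing here is about HC.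

## References
* [MumfordAV1970] D. Mumford, *Abelian Varieties* (1970), §13 (p. 125), §15 Thm. 1 (p. 143), §5 Cor. 6 (p. 54).
* [MilneAV2008] J. S. Milne, *Abelian Varieties* (2008), I §8 (pp. 36–37).
* [MumfordFogartyKirwan1994] D. Mumford, J. Fogarty, F. Kirwan, *GIT*, 3rd ed. (1994), Ch. 6 §2 (p. 121).
* [GortzWedhorn2020] U. Görtz, T. Wedhorn, *Algebraic Geometry I*, 2nd ed. (2020), Section (4.7) (pp. 107–108), Prop. 14.66.
* [Hartshorne1977] R. Hartshorne, *Algebraic Geometry*, GTM 52 (1977), III Ex. 4.5.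
-/

noncomputable section

-- `(A.baseChange f).X = (Over.pullback f).obj A.X` holds by `rfl` only; `Scheme.Modules` is not reducible.
set_option backward.isDefEq.respectTransparency false

universe u

open CategoryTheory CategoryTheory.Limits AlgebraicGeometry TopologicalSpace Opposite
open scoped MonObj

namespace Literature.AlgebraicGeometry.AbelianSchemes

namespace AbelianSchemeOver

open Literature.AlgebraicGeometry.Modules Literature.AlgebraicGeometry.Morphisms Literature.AlgebraicGeometry.Motives

variable {S : Scheme.{u}} (A : AbelianSchemeOver S)

/-! ## §1 The base-change squares of `1_A × w` -/

section Squares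

variable {T₁ T₂ : Scheme.{u}}

/-- **`A_{T₁}` is the base change of `A_{T₂}` along `w`**: the square `1_A × w`, `π_{T₁}`, `π_{T₂}`, `w` is cartesian.
[cite: GortzWedhorn2020, Section (4.7) (pp. 107–108)] -/
theorem isPullback_prodMap (f₁ : T₁ ⟶ S) (f₂ : T₂ ⟶ S) (w : T₁ ⟶ T₂) (hw : w ≫ f₂ = f₁) :
    IsPullback (A.prodMap f₁ f₂ w hw) (A.baseChange f₁).X.hom (A.baseChange f₂).X.hom w := by
  have big : IsPullback (pullback.fst A.X.hom f₁) (pullback.snd A.X.hom f₁) A.X.hom f₁ :=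
    IsPullback.of_hasPullback A.X.hom f₁
  have right : IsPullback (pullback.fst A.X.hom f₂) (pullback.snd A.X.hom f₂) A.X.hom f₂ :=
    IsPullback.of_hasPullback A.X.hom f₂
  have big' : IsPullback (A.prodMap f₁ f₂ w hw ≫ pullback.fst A.X.hom f₂) (pullback.snd A.X.hom f₁) A.X.hom (w ≫ f₂) := by
    rw [prodMap_fst, hw]; exact big
  exact IsPullback.of_right big' (A.prodMap_snd f₁ f₂ w hw) right

/-- `1_A × w` is affine for `w` affine. [cite: GortzWedhorn2020, Section (4.7) (pp. 107–108)] -/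
theorem isAffineHom_prodMap (f₁ : T₁ ⟶ S) (f₂ : T₂ ⟶ S) (w : T₁ ⟶ T₂) (hw : w ≫ f₂ = f₁) [IsAffineHom w] :
    IsAffineHom (A.prodMap f₁ f₂ w hw) :=
  MorphismProperty.of_isPullback (A.isPullback_prodMap f₁ f₂ w hw).flip inferInstance

/-- `1_A × w` is flat for `w` flat. [cite: GortzWedhorn2020, Section (4.7) (pp. 107–108)] -/
theorem flat_prodMap (f₁ : T₁ ⟶ S) (f₂ : T₂ ⟶ S) (w : T₁ ⟶ T₂) (hw : w ≫ f₂ = f₁) [Flat w] :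
    Flat (A.prodMap f₁ f₂ w hw) :=
  MorphismProperty.of_isPullback (A.isPullback_prodMap f₁ f₂ w hw).flip inferInstance

/-- `1_A × w` is surjective for `w` surjective. [cite: GortzWedhorn2020, Section (4.7) (pp. 107–108)] -/
theorem surjective_prodMap (f₁ : T₁ ⟶ S) (f₂ : T₂ ⟶ S) (w : T₁ ⟶ T₂) (hw : w ≫ f₂ = f₁) [Surjective w] :
    Surjective (A.prodMap f₁ f₂ w hw) :=
  MorphismProperty.of_isPullback (A.isPullback_prodMap f₁ f₂ w hw).flip inferInstance

variable {T₃ : Scheme.{u}}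

/-- **A kernel pair of `c : T₁ → T` gives a kernel pair of `1_A × c`**: for `IsPullback pr₁ pr₂ c c` the square
`1_A × pr₁`, `1_A × pr₂`, `1_A × c`, `1_A × c` is cartesian. [cite: GortzWedhorn2020, Section (4.7) (pp. 107–108)] -/
theorem isPullback_prodMap_prodMap {T : Scheme.{u}} (f : T ⟶ S) (c : T₁ ⟶ T) (pr₁ pr₂ : T₂ ⟶ T₁)
    (hT₂ : IsPullback pr₁ pr₂ c c) :
    IsPullback (A.prodMap (pr₁ ≫ c ≫ f) (c ≫ f) pr₁ rfl)
      (A.prodMap (pr₁ ≫ c ≫ f) (c ≫ f) pr₂ (by rw [← Category.assoc, ← hT₂.w, Category.assoc]))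
      (A.prodMap (c ≫ f) f c rfl) (A.prodMap (c ≫ f) f c rfl) := by
  set g := A.prodMap (c ≫ f) f c rfl with hg
  set p₁ := A.prodMap (pr₁ ≫ c ≫ f) (c ≫ f) pr₁ rfl with hp₁
  have hpr : pr₂ ≫ c ≫ f = pr₁ ≫ c ≫ f := by rw [← Category.assoc, ← hT₂.w, Category.assoc]
  set p₂ := A.prodMap (pr₁ ≫ c ≫ f) (c ≫ f) pr₂ hpr with hp₂
  -- the square `p₁, π₂, π₁, pr₁` pasted with `pr₁, pr₂, c, c`
  have sq₁ : IsPullback p₁ (A.baseChange (pr₁ ≫ c ≫ f)).X.hom (A.baseChange (c ≫ f)).X.hom pr₁ :=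
    A.isPullback_prodMap _ _ pr₁ rfl
  have R : IsPullback p₁ ((A.baseChange (pr₁ ≫ c ≫ f)).X.hom ≫ pr₂) ((A.baseChange (c ≫ f)).X.hom ≫ c) c :=
    sq₁.paste_vert hT₂
  have e₁ : (A.baseChange (pr₁ ≫ c ≫ f)).X.hom ≫ pr₂ = p₂ ≫ (A.baseChange (c ≫ f)).X.hom :=
    (A.prodMap_snd _ _ pr₂ hpr).symm
  have e₂ : (A.baseChange (c ≫ f)).X.hom ≫ c = g ≫ (A.baseChange f).X.hom := (A.prodMap_snd _ _ c rfl).symm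
  rw [e₁, e₂] at R
  have right : IsPullback (A.baseChange (c ≫ f)).X.hom g c (A.baseChange f).X.hom :=
    (A.isPullback_prodMap (c ≫ f) f c rfl).flip
  have comm : p₂ ≫ g = p₁ ≫ g := by
    rw [hp₂, hp₁, hg, prodMap_comp, prodMap_comp]
    exact A.prodMap_congr _ _ hT₂.w.symm _ _
  exact (IsPullback.of_right R.flip comm right).flip

end Squares

/-! ## §2 A rigidified line bundle trivial after an affine faithfully flat base change is trivial -/

namespace RigidifiedLineBundle

variable {A}

/-- **fpqc descent of trivialisations for rigidified line bundles (HECKE-LINK D6 (u6b)).**  Let `A/S` be an abelian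
scheme, `f : T → S`, `c : T₁ → T` AFFINE, flat and surjective with a kernel pair `pr₁, pr₂ : T₂ ⇉ T₁`
(`IsPullback pr₁ pr₂ c c`), and assume STEIN for `A_{T₂} → T₂` on global functions (`hSt₂`; ★ p750122
`baseChange_app_bijective` gives it for every `T₂` when `S` is locally Noetherian).  If a RIGIDIFIED line bundle `N` on
`A_T` becomes trivial on `A_{T₁}` — `(1_A × c)^* N ≅ 𝒪` — then `N ≅ 𝒪` on `A_T`.  Proof: the generic core ★
`Morphisms.TrivialisationFpqcDescent` (normalise the generator along `ε_{T₁}` by the rigidification; its two cofaces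
over `A_{T₂}` agree by LEMMA Y + Stein + torsion-freeness along `ε_{T₂}`; descend it by fpqc descent of sections ★
`Morphisms.SectionsFpqcDescent`, and `𝒪 → N` is an isomorphism because it is one after the faithfully flat `1_A × c`),
fed with the base-change squares of §1 (`1_A × c` affine, flat, surjective; `1_A × prᵢ` a kernel pair of `1_A × c`) and
★ `unitSection_comp_prodMap` / `prodMap_snd` / `unitSection_comp_hom`.  This is the step «the isomorphism
`(1 × g)^*𝒫 ≅ ℒ` descends» of the universal property of the dual of `A/K` ([MumfordAV1970] §13 p. 125, §15 Thm. 1).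
[cite: MumfordAV1970, §13 (p. 125), §15 Thm. 1 (p. 143)] [cite: MilneAV2008, I §8 pp. 36–37] [cite: GortzWedhorn2020, Prop. 14.66] -/
theorem nonempty_iso_unit_of_pullback_prodMap {T₁ T₂ T : Scheme.{u}} (f : T ⟶ S) (c : T₁ ⟶ T)
    [IsAffineHom c] [Flat c] [Surjective c] (pr₁ pr₂ : T₂ ⟶ T₁) (hT₂ : IsPullback pr₁ pr₂ c c)
    (hSt₂ : Function.Bijective ((A.baseChange (pr₁ ≫ c ≫ f)).X.hom.app ⊤)) (N : A.RigidifiedLineBundle f)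
    (h : Nonempty ((Scheme.Modules.pullback (A.prodMap (c ≫ f) f c rfl)).obj N.L ≅ SheafOfModules.unit _)) :
    Nonempty (N.L ≅ SheafOfModules.unit _) := by
  obtain ⟨φ₀⟩ := h
  obtain ⟨ρ⟩ := N.rigid
  haveI := A.isAffineHom_prodMap (c ≫ f) f c rfl
  haveI := A.flat_prodMap (c ≫ f) f c rfl
  haveI := A.surjective_prodMap (c ≫ f) f c rfl
  haveI : N.L.IsQuasicoherent := isQuasicoherent_of_hasRank N.hasRank_one
  have hpr : pr₂ ≫ c ≫ f = pr₁ ≫ c ≫ f := by rw [← Category.assoc, ← hT₂.w, Category.assoc]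
  -- the rigidification-normalised generator `s₁ := φ₀⁻¹(π₁♯ a)`
  obtain ⟨a, ha, hs₁⟩ := exists_isUnit_normalised (A.baseChange f).unitSection (A.prodMap (c ≫ f) f c rfl)
    (A.baseChange (c ≫ f)).unitSection (A.baseChange (c ≫ f)).X.hom c (A.unitSection_comp_prodMap (c ≫ f) f c rfl)
    N.L ρ φ₀ (A.baseChange (c ≫ f)).unitSection_comp_hom
  -- its two cofaces over `A_{T₂}` agree
  have hcof := cofaceFst_eq_cofaceSnd_of_stein (A.baseChange f).unitSection (A.prodMap (c ≫ f) f c rfl)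
    (A.baseChange (c ≫ f)).unitSection (A.baseChange (c ≫ f)).X.hom c N.L ρ φ₀
    (A.prodMap (pr₁ ≫ c ≫ f) (c ≫ f) pr₁ rfl) (A.prodMap (pr₁ ≫ c ≫ f) (c ≫ f) pr₂ hpr)
    (A.baseChange (pr₁ ≫ c ≫ f)).unitSection (A.baseChange (pr₁ ≫ c ≫ f)).X.hom pr₁ pr₂
    (A.unitSection_comp_prodMap (c ≫ f) f c rfl)
    (A.unitSection_comp_prodMap _ _ pr₁ rfl) (A.unitSection_comp_prodMap _ _ pr₂ hpr) hT₂.w.symm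
    (A.isPullback_prodMap_prodMap f c pr₁ pr₂ hT₂).w.symm
    (A.baseChange (pr₁ ≫ c ≫ f)).unitSection_comp_hom (A.prodMap_snd _ _ pr₁ rfl) (A.prodMap_snd _ _ pr₂ hpr)
    hSt₂.2 a hs₁
  -- descend
  exact nonempty_iso_unit_of_cofaceFst_eq_cofaceSnd (A.prodMap (c ≫ f) f c rfl)
    (A.prodMap (pr₁ ≫ c ≫ f) (c ≫ f) pr₁ rfl) (A.prodMap (pr₁ ≫ c ≫ f) (c ≫ f) pr₂ hpr) N.L φ₀
    (A.isPullback_prodMap_prodMap f c pr₁ pr₂ hT₂) _ (ha.map ((A.baseChange (c ≫ f)).X.hom.app ⊤).hom) hcof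

/-- The same over a locally Noetherian `S`, where STEIN holds for every `A_{T′} → T′` (★ p750122
`baseChange_app_bijective`): **a rigidified line bundle on `A_T` which is trivial on `A_{T₁}` for an affine faithfully
flat `T₁ → T` is trivial.** [cite: MumfordAV1970, §13 (p. 125), §15 Thm. 1 (p. 143)] [cite: MilneAV2008, I §8 pp. 36–37] -/
theorem nonempty_iso_unit_of_pullback_prodMap_of_isLocallyNoetherian [IsLocallyNoetherian S] {T₁ T₂ T : Scheme.{u}}
    (f : T ⟶ S) (c : T₁ ⟶ T) [IsAffineHom c] [Flat c] [Surjective c] (pr₁ pr₂ : T₂ ⟶ T₁)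
    (hT₂ : IsPullback pr₁ pr₂ c c) (N : A.RigidifiedLineBundle f)
    (h : Nonempty ((Scheme.Modules.pullback (A.prodMap (c ≫ f) f c rfl)).obj N.L ≅ SheafOfModules.unit _)) :
    Nonempty (N.L ≅ SheafOfModules.unit _) :=
  nonempty_iso_unit_of_pullback_prodMap f c pr₁ pr₂ hT₂ (A.baseChange_app_bijective (pr₁ ≫ c ≫ f) ⊤) N h

/-- The chosen-pullback spelling: kernel pair `Limits.pullback c c`. [cite: MumfordAV1970, §13 (p. 125), §15 Thm. 1 (p. 143)] -/
theorem nonempty_iso_unit_of_pullback_prodMap_of_isLocallyNoetherian' [IsLocallyNoetherian S] {T₁ T : Scheme.{u}}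
    (f : T ⟶ S) (c : T₁ ⟶ T) [IsAffineHom c] [Flat c] [Surjective c] (N : A.RigidifiedLineBundle f)
    (h : Nonempty ((Scheme.Modules.pullback (A.prodMap (c ≫ f) f c rfl)).obj N.L ≅ SheafOfModules.unit _)) :
    Nonempty (N.L ≅ SheafOfModules.unit _) :=
  nonempty_iso_unit_of_pullback_prodMap_of_isLocallyNoetherian f c (pullback.fst c c) (pullback.snd c c)
    (IsPullback.of_hasPullback c c) N h

end RigidifiedLineBundle

/-! ## §3 The two-module form: rigidified line bundles isomorphic after `1_A × c` are isomorphic -/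

namespace RigidifiedLineBundle

variable {A}

/-- **Two rigidified line bundles on `A_T` which become isomorphic on `A_{T₁}` after an affine faithfully flat
`c : T₁ → T` are isomorphic** (the form consumed by the universal property of the dual of `A/K`: «the isomorphism
`(1 × g)^*𝒫 ≅ ℒ` descends», [MumfordAV1970] §13 p. 125).  Apply the one-module form to `N := M₁ ⊗ M₂^∨`, a rigidified
line bundle (`[det ε_T^*N] = ε_T^*([M₁][M₂]⁻¹) = 1`, ★ `cechPic_pullback_unitSection_detClass`, ★
`nonempty_iso_unitModule_of_detClass_eq_one`) which is trivial on `A_{T₁}` (`[det (1×c)^*N] = [(1×c)^*M₁][(1×c)^*M₂]⁻¹ = 1`),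
and read `N ≅ 𝒪` back as `[M₁] = [M₂]` (★ `nonempty_iso_iff_detClass_eq`; ★ `detClass_tensorObj_of_hasRank_one`, ★
`detClass_dual'`). [cite: MumfordAV1970, §13 (p. 125), §15 Thm. 1 (p. 143)] [cite: MilneAV2008, I §8 pp. 36–37] [cite: Hartshorne1977, III Ex. 4.5] -/
theorem nonempty_iso_of_pullback_prodMap {T₁ T₂ T : Scheme.{u}} (f : T ⟶ S) (c : T₁ ⟶ T)
    [IsAffineHom c] [Flat c] [Surjective c] (pr₁ pr₂ : T₂ ⟶ T₁) (hT₂ : IsPullback pr₁ pr₂ c c)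
    (hSt₂ : Function.Bijective ((A.baseChange (pr₁ ≫ c ≫ f)).X.hom.app ⊤)) (M₁ M₂ : A.RigidifiedLineBundle f)
    (h : Nonempty ((Scheme.Modules.pullback (A.prodMap (c ≫ f) f c rfl)).obj M₁.L ≅
      (Scheme.Modules.pullback (A.prodMap (c ≫ f) f c rfl)).obj M₂.L)) :
    Nonempty (M₁.L ≅ M₂.L) := by
  obtain ⟨φ⟩ := h
  have h₁ : HasRank M₁.L 1 := M₁.hasRank_one
  have h₂ : HasRank M₂.L 1 := M₂.hasRank_one
  have h₂d : HasRank (Modules.dual M₂.L) 1 := hasRank_dual h₂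
  have hN : HasRank (tensorObj M₁.L (Modules.dual M₂.L)) 1 := hasRank_tensorObj_one h₁ h₂d
  have h₁f := HasRank.isFiniteLocallyFree' h₁
  have h₂f := HasRank.isFiniteLocallyFree' h₂
  have h₂df := HasRank.isFiniteLocallyFree' h₂d
  have hNf := HasRank.isFiniteLocallyFree' hN
  -- `[det N] = [M₁] · [M₂]⁻¹`
  have hdet : detClass hNf = detClass h₁f * (detClass h₂f)⁻¹ := by
    rw [detClass_tensorObj_of_hasRank_one h₁ h₂d h₁f h₂df hNf, detClass_dual' h₂f h₂df]
  -- `N` is rigidified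
  have hrig : Nonempty ((Scheme.Modules.pullback (A.baseChange f).unitSection).obj (tensorObj M₁.L (Modules.dual M₂.L)) ≅
      SheafOfModules.unit _) :=
    nonempty_iso_unitModule_of_detClass_eq_one (hasRank_pullback _ hN) (hNf.pullback _) (by
      rw [detClass_pullback (A.baseChange f).unitSection hNf, hdet, map_mul, map_inv,
        M₁.cechPic_pullback_unitSection_detClass h₁f, M₂.cechPic_pullback_unitSection_detClass h₂f, inv_one, mul_one])
  let N : A.RigidifiedLineBundle f := ⟨tensorObj M₁.L (Modules.dual M₂.L), hN, hrig⟩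
  -- `(1_A × c)^* N ≅ 𝒪`
  have htriv : Nonempty ((Scheme.Modules.pullback (A.prodMap (c ≫ f) f c rfl)).obj N.L ≅ SheafOfModules.unit _) :=
    nonempty_iso_unitModule_of_detClass_eq_one (hasRank_pullback _ hN) (hNf.pullback (A.prodMap (c ≫ f) f c rfl)) (by
      rw [detClass_pullback (A.prodMap (c ≫ f) f c rfl) hNf, hdet, map_mul, map_inv,
        ← detClass_pullback (A.prodMap (c ≫ f) f c rfl) h₁f, ← detClass_pullback (A.prodMap (c ≫ f) f c rfl) h₂f,
        detClass_eq_of_iso φ (h₁f.pullback (A.prodMap (c ≫ f) f c rfl)) (h₂f.pullback (A.prodMap (c ≫ f) f c rfl)),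
        mul_inv_cancel])
  -- the one-module form, read back on determinant classes
  obtain ⟨e⟩ := nonempty_iso_unit_of_pullback_prodMap f c pr₁ pr₂ hT₂ hSt₂ N htriv
  have hN1 : detClass hNf = 1 :=
    (detClass_eq_of_iso e hNf (HasRank.isFiniteLocallyFree' hasRank_unitModule)).trans (detClass_unitModule_eq_one _)
  rw [hdet] at hN1
  exact (nonempty_iso_iff_detClass_eq h₁ h₂ h₁f h₂f).2 (mul_inv_eq_one.mp hN1)

/-- Two-module form over a locally Noetherian `S` (Stein by ★ p750122 `baseChange_app_bijective`), free kernel pair.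
[cite: MumfordAV1970, §13 (p. 125), §15 Thm. 1 (p. 143)] [cite: MilneAV2008, I §8 pp. 36–37] -/
theorem nonempty_iso_of_pullback_prodMap_of_isLocallyNoetherian_of_isPullback [IsLocallyNoetherian S]
    {T₁ T₂ T : Scheme.{u}} (f : T ⟶ S) (c : T₁ ⟶ T) [IsAffineHom c] [Flat c] [Surjective c]
    (pr₁ pr₂ : T₂ ⟶ T₁) (hT₂ : IsPullback pr₁ pr₂ c c) (M₁ M₂ : A.RigidifiedLineBundle f)
    (h : Nonempty ((Scheme.Modules.pullback (A.prodMap (c ≫ f) f c rfl)).obj M₁.L ≅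
      (Scheme.Modules.pullback (A.prodMap (c ≫ f) f c rfl)).obj M₂.L)) :
    Nonempty (M₁.L ≅ M₂.L) :=
  nonempty_iso_of_pullback_prodMap f c pr₁ pr₂ hT₂ (A.baseChange_app_bijective (pr₁ ≫ c ≫ f) ⊤) M₁ M₂ h

/-- **Two rigidified line bundles on `A_T` (over a locally Noetherian `S`) which become isomorphic after an affine
faithfully flat base change `T₁ → T` are isomorphic** — the Stein-free, kernel-pair-free form (`T₂ := T₁ ×_T T₁`):
the `hdesc` input of the universal property of `(Â/K′, 𝒫_B^{rig})`. [cite: MumfordAV1970, §13 (p. 125), §15 Thm. 1 (p. 143)]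
[cite: MilneAV2008, I §8 pp. 36–37] -/
theorem nonempty_iso_of_pullback_prodMap_of_isLocallyNoetherian [IsLocallyNoetherian S] {T₁ T : Scheme.{u}}
    (f : T ⟶ S) (c : T₁ ⟶ T) [IsAffineHom c] [Flat c] [Surjective c] (M₁ M₂ : A.RigidifiedLineBundle f)
    (h : Nonempty ((Scheme.Modules.pullback (A.prodMap (c ≫ f) f c rfl)).obj M₁.L ≅
      (Scheme.Modules.pullback (A.prodMap (c ≫ f) f c rfl)).obj M₂.L)) :
    Nonempty (M₁.L ≅ M₂.L) :=
  nonempty_iso_of_pullback_prodMap_of_isLocallyNoetherian_of_isPullback f c (pullback.fst c c) (pullback.snd c c)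
    (IsPullback.of_hasPullback c c) M₁ M₂ h

end RigidifiedLineBundle

end AbelianSchemeOver

end Literature.AlgebraicGeometry.AbelianSchemes

end
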